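import Summits.SmoothPoincare4.SmoothPoincare4.Theorems.CongruenceShadowsNormalFormStablyTrivialLuftReduction
import Literature.Topology.FourManifolds.SurfaceGroupNielsenTheorem

/-!
# Line `luft-twist-reduction` for crux `NormalFormStablyTrivial` (stmt-SmoothPoincare4-14591):
# with Nielsen's theorem proved, the crux IS the twist gate

Nielsen's lifting theorem for surface-group automorphisms (`nielsen_surfaceGroup_mulEquiv_lift`),
the one named fact the Luft reduction of this line was conditional on, is now a theorem of the tree
(`nielsen_surfaceGroup_mulEquiv_lift_holds`, Zieschang's algebraic proof, LNM 835 Thm. 5.6.1,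
formalised in `Literature/Topology/FourManifolds/SurfaceGroupNielsen*.lean` and
`Literature/GroupTheory/CombinatorialGroupTheory/BinaryProduct*.lean`).  Consequently the
conditional results of `…LuftReduction.lean` become unconditional:

(The former stub `stub_nielsenLift` is `Literature.Topology.FourManifolds.nielsen_surfaceGroup_mulEquiv_lift_holds` itself.)

* `goeritzPadding_holds`, `luftReduction_holds` — every gate triple of the trivial group is stably
  isomorphic, by an element of the Goeritz group, to a gate triple with standard free shadow;
* `normalFormStablyTrivial_iff_twistGate` — **the crux `NormalFormStablyTrivial` is EQUIVALENT to
  the twist gate `TwistGate`** (a gate triple with standard free shadow is stably trivial), the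
  registered residual stub of the line's skeleton.
-/

-- the prescribed namespace `Summit.<P>.<Sub>.…` duplicates `SmoothPoincare4` (P = Sub)
set_option linter.dupNamespace false

namespace Summit.SmoothPoincare4.SmoothPoincare4.Theorems.NormalFormStablyTrivial.Luft

open Literature.Topology.FourManifolds
open Summit.SmoothPoincare4.SmoothPoincare4.Theses.CongruenceShadows (NormalFormStablyTrivial)

/-- **Goeritz padding holds** (unconditionally). -/
theorem goeritzPadding_holds : GoeritzPadding :=
  goeritzPadding_of_nielsen nielsen_surfaceGroup_mulEquiv_lift_holds

/-- **The Luft reduction holds** (unconditionally): every gate triple is stably isomorphic to a gate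
triple with standard free shadow. -/
theorem luftReduction_holds : LuftReduction :=
  luftReduction_of_nielsen nielsen_surfaceGroup_mulEquiv_lift_holds

/-- **The crux is equivalent to the twist gate** (unconditionally). -/
theorem helper_normalFormStablyTrivial_iff_twistGate : Summit.SmoothPoincare4.SmoothPoincare4.Theses.CongruenceShadows.NormalFormStablyTrivial ↔ Summit.SmoothPoincare4.SmoothPoincare4.Theorems.NormalFormStablyTrivial.Luft.TwistGate :=
  normalFormStablyTrivial_iff_twistGate_of_nielsen nielsen_surfaceGroup_mulEquiv_lift_holds

end Summit.SmoothPoincare4.SmoothPoincare4.Theorems.NormalFormStablyTrivial.Luft
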